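import Literature.NumberTheory.EllipticCurves.IwasawaMuLambdaDefinitions
import Literature.NumberTheory.EllipticCurves.DescendedFrobeniusNineIntegers
import Literature.NumberTheory.EllipticCurves.DescendedFrobeniusFormalGroupToolkit
import Literature.NumberTheory.EllipticCurves.DescendedFrobeniusKatzRank
import HarnessLib

/-!
# The descended crystalline Frobenius matrix at `3` over `ℚ₃(ζ₉)` (Katz 1981, Berthelot–Ogus 1983), 5/5 — Galois descent to `ℚ₃`, the rank-two reduction and `WeierstrassCurve.isDescendedFrobeniusMatrix_exists` HOLDS (re-homed proofs)

**The named fact `WeierstrassCurve.isDescendedFrobeniusMatrix_exists` (`DescendedFrobeniusMatrix.lean`: for `W/ℚ` with a good model over `𝓞_L`,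
`L = ℚ₃(ζ₉)`, of supersingular special fibre, a descended crystalline Frobenius matrix `M ∈ M₂(ℚ₃)` exists and `tr M = a`) HOLDS — EXACT name
`WeierstrassCurve.isDescendedFrobeniusMatrix_exists_holds`** ([Katz1981CrystallineDieudonne] N. Katz, *Crystalline cohomology, Dieudonné modules, and Jacobi sums*,
Thm. 5.1.4, 5.3.3, (5.5.7), 5.7.2, (6.1.1); [BerthelotOgus1983] (2.4), (3.14); Honda's theory of formal groups and the Katz–Messing point-count relation
`φ² − aφ + 3 = 0`).  Contents: (1, definitions file) `μ`, `λ`, the reduction mod `p` and the `p`-free part of a power series over `ℤ_p`;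
(2–4) the ring `𝓞_L = ℤ₃[ζ₉]` (`ONine`: integers, residue map, local structure, integral coordinates), transfer of the descended Frobenius along good
models (semantics, basis, good-model transport and its calculus), the formal endomorphism algebra and its `p`-adic digits, Katz's Frobenius modulo `ϖ` and
the Frobenius relation, bounded formal logarithms `⇔` divisibility, the `p`-adic rank-two assembly, coefficient computations in the formal group of a
Weierstrass curve (`formalW`, `formalΩ`, `formalLog`), the formal `η`-coboundary and residue, Honda estimates and congruences, unbounded `log`, `η`-integrality,
independence of the classes `[ω], [η]`, the second-kind logarithm, the Katz rank of a `p`-adic rank, the supersingular Katz rank, the `p`-adic digit limit;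
(5) Galois descent from `L` to `ℚ₃`, the named fact from the Katz rank, the rank-two reduction, and the discharge.
RE-HOMED into `Literature/` by the Hodge foundations lane (`lit-hodgefound`, seat p20, generation 40): verbatim DECLARATION-LEVEL ports (the 331 declarations needed, in
dependency order; each Part is a slice of one Summits module) of 45 theorem modules `Summits/BirchSwinnertonDyer/BirchSwinnertonDyer/Theorems/CyclotomicUntwist*.lean`
(+ three formal-group coefficient files and `Rank1Residual/{X1/MuLambdaAlgebra,O5/…}`); the namespace `Summit.BirchSwinnertonDyer.BirchSwinnertonDyer.Theorems` is re-rooted at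
`Literature.NumberTheory.EllipticCurves.DescendedFrobenius` (module sub-namespaces kept; the coefficient lemmas gathered in `….FormalGroupCoefficients`, the two `3`-adic norm lemmas in
`….PadicNormAux`, `μ`/`λ` in `Literature.NumberTheory.EllipticCurves.MuLambda`).  No new named fact (D-0026); imports Mathlib/Literature only; every declaration carries the citation of the
printed statement it formalises or serves.  The Summits originals stay in place (transitional duplication).  WHAT THIS IS NOT: nothing here bears on BSD; it is the
crystalline / formal-group computation of the Frobenius matrix at `3` for curves acquiring good reduction over `ℚ₃(ζ₉)`.  (This is file 5 of 5; it carries `WeierstrassCurve.isDescendedFrobeniusMatrix_exists_holds`.)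
-/

noncomputable section

/-!
## Part 1 — port of `Summits/BirchSwinnertonDyer/BirchSwinnertonDyer/Theorems/CyclotomicUntwistNineGaloisDescent.lean` (5 declarations kept)

# Galois descent on the `ω`-plane of Katz's module over `𝓞_{ℚ₃(ζ₉)}`: conjugate good models, independence of `([ω], φ[ω])`, and `ℚ₃`-rationality of the `ω`-column — the named fact from the `η`-position

Declarations of this Part (verbatim port; each keeps its own docstring and citation): `eigenvalue_fixed`, `not_hbd_expand_sub_C_mul_classOmega`, `omegaPlane_independent`, `omegaColumn_rational`, `isDescendedFrobeniusMatrix_exists_of_etaPosition`.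

Reference keys (see `references.bib` and the declarations' citations): [Katz1981CrystallineDieudonne], [BerthelotOgus1983].
-/

section Part1

open scoped _root_.Classical
open _root_.PowerSeries _root_.IsCyclotomicExtension Literature.NumberTheory.EllipticCurves.DescendedFrobenius
  Literature.NumberTheory.EllipticCurves.DescendedFrobenius.NineIntegers
  Literature.NumberTheory.EllipticCurves.DescendedFrobenius.NineHondaEstimate
  Literature.NumberTheory.EllipticCurves.DescendedFrobenius.DescendedFrobeniusTransfer
  Literature.NumberTheory.EllipticCurves.DescendedFrobenius.NineHonda
  Literature.NumberTheory.EllipticCurves.DescendedFrobenius.NineLogUnbounded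
  Literature.NumberTheory.EllipticCurves.DescendedFrobenius.NineDescendedFrobeniusOfOmegaColumn

namespace Literature.NumberTheory.EllipticCurves.DescendedFrobenius.NineGaloisDescent

variable {W : WeierstrassCurve ℚ}

/-- **Eigenvalues of `φ` on the `ω`-line are `Gal(ℚ₃(ζ₉)/ℚ₃)`-fixed**, granted the transport `hT` of `ω`-column
statements between good models: conjugate `φ[ω] ≡ λ[ω]` to the model `𝓜^τ` (eigenvalue `τλ`), transport back to
`𝓜`, and compare by `NineLogUnbounded.eigenvalue_unique`. [cite: BerthelotOgus1983, Prop. (3.14)]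
[cite: Katz1981CrystallineDieudonne, Thm. 5.3.3] -/
theorem eigenvalue_fixed (𝓜 : W.NineGoodModel) (ρ : ONine →+* ZMod 3)
    (hT : ∀ 𝓜₁ 𝓜₂ : W.NineGoodModel, ∀ c d : KNine,
      HasBoundedDenominators (expand 3 (by norm_num) 𝓜₂.classOmega - PowerSeries.C c * 𝓜₂.classOmega -
        PowerSeries.C d * 𝓜₂.classEta) →
      HasBoundedDenominators (expand 3 (by norm_num) 𝓜₁.classOmega - PowerSeries.C c * 𝓜₁.classOmega -
        PowerSeries.C d * 𝓜₁.classEta))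
    {lam : KNine} (h : HasBoundedDenominators (expand 3 (by norm_num) 𝓜.classOmega - PowerSeries.C lam * 𝓜.classOmega))
    (τ : KNine ≃ₐ[ℚ_[3]] KNine) : τ lam = lam := by
  obtain ⟨𝓜', hΩ, hH⟩ := exists_conj_nineGoodModel 𝓜 τ
  -- conjugate the eigen-relation to `𝓜'`
  have h' : HasBoundedDenominators (expand 3 (by norm_num) 𝓜'.classOmega - PowerSeries.C (τ lam) * 𝓜'.classOmega -
      PowerSeries.C 0 * 𝓜'.classEta) := by
    have hm := hbd_map τ h
    rw [map_sub, map_mul, map_C, map_expand, ← hΩ] at hm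
    rw [map_zero, zero_mul, sub_zero]
    exact hm
  -- transport back to `𝓜` and compare
  have hback := hT 𝓜 𝓜' (τ lam) 0 h'
  rw [map_zero, zero_mul, sub_zero] at hback
  exact (eigenvalue_unique 𝓜 ρ h hback).symm

/-- **No eigenvalue at all on the `ω`-line of a supersingular good model** (`3 ∣ a`), granted the transport `hT`:
an eigenvalue would be Galois-fixed, hence in `ℚ₃`, contradicting `not_hbd_expand_sub_algebraMap_mul_classOmega`.
[cite: Katz1981CrystallineDieudonne, Thm. 5.3.3 and (6.1.1)] -/
theorem not_hbd_expand_sub_C_mul_classOmega (𝓜 : W.NineGoodModel) (ρ : ONine →+* ZMod 3)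
    (hss : (3 : ℤ) ∣ 𝓜.specialFibreTrace ρ)
    (hT : ∀ 𝓜₁ 𝓜₂ : W.NineGoodModel, ∀ c d : KNine,
      HasBoundedDenominators (expand 3 (by norm_num) 𝓜₂.classOmega - PowerSeries.C c * 𝓜₂.classOmega -
        PowerSeries.C d * 𝓜₂.classEta) →
      HasBoundedDenominators (expand 3 (by norm_num) 𝓜₁.classOmega - PowerSeries.C c * 𝓜₁.classOmega -
        PowerSeries.C d * 𝓜₁.classEta))
    (lam : KNine) :
    ¬ HasBoundedDenominators (expand 3 (by norm_num) 𝓜.classOmega - PowerSeries.C lam * 𝓜.classOmega) := by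
  intro h
  haveI : FiniteDimensional ℚ_[3] KNine := IsCyclotomicExtension.finite {9} ℚ_[3] KNine
  haveI : IsGalois ℚ_[3] KNine := IsCyclotomicExtension.isGalois {9} ℚ_[3] KNine
  have hfix : ∀ τ : KNine ≃ₐ[ℚ_[3]] KNine, τ lam = lam := fun τ => eigenvalue_fixed 𝓜 ρ hT h τ
  obtain ⟨μ, hμ⟩ := (IsGalois.mem_range_algebraMap_iff_fixed lam).mpr hfix
  rw [← hμ] at h
  exact not_hbd_expand_sub_algebraMap_mul_classOmega 𝓜 ρ hss μ h

/-- **`([ω], φ[ω])` is independent modulo bounded denominators** on a good model with supersingular special fibre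
(granted the transport `hT`): `x[ω] + y·φ[ω] ≡ 0` forces `x = y = 0`. This is the kernel form of the lower bound
`rk D(Ê/𝓞) ⊗ ℚ ≥ 2`. [cite: Katz1981CrystallineDieudonne, Thm. 5.3.3] -/
theorem omegaPlane_independent (𝓜 : W.NineGoodModel) (ρ : ONine →+* ZMod 3)
    (hss : (3 : ℤ) ∣ 𝓜.specialFibreTrace ρ)
    (hT : ∀ 𝓜₁ 𝓜₂ : W.NineGoodModel, ∀ c d : KNine,
      HasBoundedDenominators (expand 3 (by norm_num) 𝓜₂.classOmega - PowerSeries.C c * 𝓜₂.classOmega -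
        PowerSeries.C d * 𝓜₂.classEta) →
      HasBoundedDenominators (expand 3 (by norm_num) 𝓜₁.classOmega - PowerSeries.C c * 𝓜₁.classOmega -
        PowerSeries.C d * 𝓜₁.classEta))
    (x y : KNine) (hxy : HasBoundedDenominators (PowerSeries.C x * 𝓜.classOmega +
      PowerSeries.C y * expand 3 (by norm_num) 𝓜.classOmega)) : x = 0 ∧ y = 0 := by
  by_cases hy : y = 0
  · rw [hy, map_zero, zero_mul, add_zero] at hxy
    exact ⟨eq_zero_of_hbd_C_mul_classOmega 𝓜 ρ hxy, hy⟩
  · exfalso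
    have h := hbd_C_mul y⁻¹ hxy
    have e : PowerSeries.C y⁻¹ * (PowerSeries.C x * 𝓜.classOmega + PowerSeries.C y * expand 3 (by norm_num) 𝓜.classOmega) =
        expand 3 (by norm_num) 𝓜.classOmega - PowerSeries.C (-(x * y⁻¹)) * 𝓜.classOmega := by
      rw [map_neg, map_mul]
      linear_combination (expand 3 (by norm_num) 𝓜.classOmega) * (C_mul_C_inv hy)
    rw [e] at h
    exact not_hbd_expand_sub_C_mul_classOmega 𝓜 ρ hss hT _ h

/-- **The `ω`-column is `ℚ₃`-rational.** If `φ[ω] ≡ c[ω] + d[η]` on a good model with supersingular special fibre,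
`c, d ∈ ℚ₃(ζ₉)`, `d ≠ 0`, then (granted the transport `hT`) `c` and `d` are `Gal(ℚ₃(ζ₉)/ℚ₃)`-fixed, i.e. lie in `ℚ₃`:
conjugate the relation to `𝓜^τ`, transport it back to `𝓜`, subtract, and use `ClassesIndependent`.
[cite: BerthelotOgus1983, Prop. (3.14)] [cite: Katz1981CrystallineDieudonne, Thm. 5.3.3] -/
theorem omegaColumn_rational (𝓜 : W.NineGoodModel) (ρ : ONine →+* ZMod 3) (hss : (3 : ℤ) ∣ 𝓜.specialFibreTrace ρ)
    (hT : ∀ 𝓜₁ 𝓜₂ : W.NineGoodModel, ∀ c d : KNine,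
      HasBoundedDenominators (expand 3 (by norm_num) 𝓜₂.classOmega - PowerSeries.C c * 𝓜₂.classOmega -
        PowerSeries.C d * 𝓜₂.classEta) →
      HasBoundedDenominators (expand 3 (by norm_num) 𝓜₁.classOmega - PowerSeries.C c * 𝓜₁.classOmega -
        PowerSeries.C d * 𝓜₁.classEta))
    {c d : KNine} (hd : d ≠ 0)
    (hω : HasBoundedDenominators (expand 3 (by norm_num) 𝓜.classOmega - PowerSeries.C c * 𝓜.classOmega -
      PowerSeries.C d * 𝓜.classEta)) :
    ∃ c₀ d₀ : ℚ_[3], algebraMap ℚ_[3] KNine c₀ = c ∧ algebraMap ℚ_[3] KNine d₀ = d := by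
  haveI : FiniteDimensional ℚ_[3] KNine := IsCyclotomicExtension.finite {9} ℚ_[3] KNine
  haveI : IsGalois ℚ_[3] KNine := IsCyclotomicExtension.isGalois {9} ℚ_[3] KNine
  have hI := classesIndependent_of_omegaColumn' 𝓜 hd hω (omegaPlane_independent 𝓜 ρ hss hT)
  have hfix : ∀ τ : KNine ≃ₐ[ℚ_[3]] KNine, τ c = c ∧ τ d = d := by
    intro τ
    obtain ⟨𝓜', hΩ, hH⟩ := exists_conj_nineGoodModel 𝓜 τ
    have hm := hbd_map τ hω
    rw [map_sub, map_sub, map_mul, map_mul, map_C, map_C, map_expand, ← hΩ, ← hH] at hm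
    simp only [RingHom.coe_coe] at hm
    have hback := hT 𝓜 𝓜' _ _ hm
    have hdiff := hω.sub hback
    have e : expand 3 (by norm_num) 𝓜.classOmega - PowerSeries.C c * 𝓜.classOmega - PowerSeries.C d * 𝓜.classEta -
        (expand 3 (by norm_num) 𝓜.classOmega - PowerSeries.C (τ c) * 𝓜.classOmega -
          PowerSeries.C (τ d) * 𝓜.classEta) =
        (τ c - c) • 𝓜.classOmega + (τ d - d) • 𝓜.classEta := by
      rw [smul_eq_C_mul, smul_eq_C_mul, map_sub, map_sub]
      ring
    rw [e] at hdiff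
    obtain ⟨h1, h2⟩ := hI _ _ hdiff
    exact ⟨(sub_eq_zero.mp h1), (sub_eq_zero.mp h2)⟩
  obtain ⟨c₀, hc₀⟩ := (IsGalois.mem_range_algebraMap_iff_fixed c).mpr fun τ => (hfix τ).1
  obtain ⟨d₀, hd₀⟩ := (IsGalois.mem_range_algebraMap_iff_fixed d).mpr fun τ => (hfix τ).2
  exact ⟨c₀, d₀, hc₀, hd₀⟩

/-- **`isDescendedFrobeniusMatrix_exists` FROM THE POSITION OF THE SECOND NÉRON CLASS.** Granted, for every `W` with a good
model over `𝓞`: (T) the transport of `ω`-column statements between any two good models of `W`, and (H) on every good model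
with supersingular special fibre some `A, B ∈ ℚ₃(ζ₉)`, `B ≠ 0`, with `[η_W] ≡ A[ω_W] + B·φ[ω_W]` modulo bounded
denominators — the named fact holds: the `ω`-column `(c, d) = (−A/B, 1/B)` is `ℚ₃`-rational (`omegaColumn_rational`),
transports to every model (T), the `ω`-plane is independent on every model (`omegaPlane_independent`), and
`NineDescendedFrobeniusOfOmegaColumn.isDescendedFrobeniusMatrix_of_omegaColumn` produces THE matrix with `det 3`, `tr a`.
(T) is kernel-sized (formal-group isomorphism between good models, g8); (H) is the printed rank-2 statement.
[cite: Katz1981CrystallineDieudonne, Thm. 5.3.3 and §5.9] [cite: BerthelotOgus1983, Thm. (2.4) and Prop. (3.14)] -/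
theorem isDescendedFrobeniusMatrix_exists_of_etaPosition
    (hT : ∀ (W : WeierstrassCurve ℚ) (𝓜₁ 𝓜₂ : W.NineGoodModel) (c d : KNine),
      HasBoundedDenominators (expand 3 (by norm_num) 𝓜₂.classOmega - PowerSeries.C c * 𝓜₂.classOmega -
        PowerSeries.C d * 𝓜₂.classEta) →
      HasBoundedDenominators (expand 3 (by norm_num) 𝓜₁.classOmega - PowerSeries.C c * 𝓜₁.classOmega -
        PowerSeries.C d * 𝓜₁.classEta))
    (hH : ∀ (W : WeierstrassCurve ℚ) (𝓜 : W.NineGoodModel) (ρ : ONine →+* ZMod 3),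
      (3 : ℤ) ∣ 𝓜.specialFibreTrace ρ →
        ∃ A B : KNine, B ≠ 0 ∧ HasBoundedDenominators (𝓜.classEta - PowerSeries.C A * 𝓜.classOmega -
          PowerSeries.C B * expand 3 (by norm_num) 𝓜.classOmega)) :
    WeierstrassCurve.isDescendedFrobeniusMatrix_exists := by
  intro W 𝓜 ρ hss
  haveI := isElliptic_of_nineGoodModel 𝓜
  obtain ⟨A, B, hB, hη⟩ := hH W 𝓜 ρ hss
  -- the `ω`-column over `ℚ₃(ζ₉)`: `φΩ − (−A/B)Ω − B⁻¹ η = −B⁻¹ · (η − AΩ − BφΩ)`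
  have hω : HasBoundedDenominators (expand 3 (by norm_num) 𝓜.classOmega - PowerSeries.C (-(A * B⁻¹)) * 𝓜.classOmega -
      PowerSeries.C B⁻¹ * 𝓜.classEta) := by
    have h := hbd_C_mul (-B⁻¹) hη
    have e : PowerSeries.C (-B⁻¹) * (𝓜.classEta - PowerSeries.C A * 𝓜.classOmega -
        PowerSeries.C B * expand 3 (by norm_num) 𝓜.classOmega) =
        expand 3 (by norm_num) 𝓜.classOmega - PowerSeries.C (-(A * B⁻¹)) * 𝓜.classOmega -
          PowerSeries.C B⁻¹ * 𝓜.classEta := by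
      rw [map_neg, map_neg, map_mul]
      linear_combination (expand 3 (by norm_num) 𝓜.classOmega) * C_mul_C_inv hB
    rwa [e] at h
  have hd : (B⁻¹ : KNine) ≠ 0 := inv_ne_zero hB
  -- rationality of the column
  obtain ⟨c₀, d₀, hc₀, hd₀⟩ := omegaColumn_rational 𝓜 ρ hss (hT W) hd hω
  have hd₀ne : d₀ ≠ 0 := by
    rintro rfl
    rw [map_zero] at hd₀
    exact hd hd₀.symm
  rw [← hc₀, ← hd₀] at hω
  -- every model: same column (transport), independent `ω`-plane (trace is model-independent)
  have hω_all : ∀ 𝓜' : W.NineGoodModel, HasBoundedDenominators (expand 3 (by norm_num) 𝓜'.classOmega -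
      PowerSeries.C (algebraMap ℚ_[3] KNine c₀) * 𝓜'.classOmega -
      PowerSeries.C (algebraMap ℚ_[3] KNine d₀) * 𝓜'.classEta) := fun 𝓜' => hT W 𝓜' 𝓜 _ _ hω
  have hind_all : ∀ 𝓜' : W.NineGoodModel, ∀ x y : KNine, HasBoundedDenominators (PowerSeries.C x * 𝓜'.classOmega +
      PowerSeries.C y * expand 3 (by norm_num) 𝓜'.classOmega) → x = 0 ∧ y = 0 := fun 𝓜' => by
    have hss' : (3 : ℤ) ∣ 𝓜'.specialFibreTrace ρ := by
      rw [← specialFibreTrace_eq_of_nineGoodModel 𝓜 𝓜' ρ]; exact hss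
    exact omegaPlane_independent 𝓜' ρ hss' (hT W)
  exact ⟨_, isDescendedFrobeniusMatrix_of_omegaColumn 𝓜 ρ hd₀ne hω_all hind_all⟩

end Literature.NumberTheory.EllipticCurves.DescendedFrobenius.NineGaloisDescent

end Part1

/-!
## Part 2 — port of `Summits/BirchSwinnertonDyer/BirchSwinnertonDyer/Theorems/CyclotomicUntwistNineNamedFactOfKatzRank.lean` (1 declarations kept)

# `isDescendedFrobeniusMatrix_exists` from Katz's rank theorem (Dieudonné rank `=` height `≤ 2`), the second-kind property of `[η_W]` and `[η_W] ∉ L·[ω_W]` — the print input of C2 re-typed as one cited rank statement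

Declarations of this Part (verbatim port; each keeps its own docstring and citation): `isDescendedFrobeniusMatrix_exists_of_katzRankLeTwo_supersingular`.

Reference keys (see `references.bib` and the declarations' citations): [Katz1981CrystallineDieudonne], [BerthelotOgus1983].
-/

section Part2

open scoped _root_.Classical
open _root_.PowerSeries _root_.IsCyclotomicExtension Literature.NumberTheory.EllipticCurves.DescendedFrobenius
  Literature.NumberTheory.EllipticCurves.DescendedFrobenius.NineIntegers
  Literature.NumberTheory.EllipticCurves.DescendedFrobenius.NineHondaEstimate
  Literature.NumberTheory.EllipticCurves.DescendedFrobenius.DescendedFrobeniusTransfer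
  Literature.NumberTheory.EllipticCurves.DescendedFrobenius.NineHonda
  Literature.NumberTheory.EllipticCurves.DescendedFrobenius.NineLogUnbounded
  Literature.NumberTheory.EllipticCurves.DescendedFrobenius.NineDescendedFrobeniusOfOmegaColumn
  Literature.NumberTheory.EllipticCurves.DescendedFrobenius.NineGaloisDescent
  Literature.NumberTheory.EllipticCurves.DescendedFrobenius.DescendedFrobeniusOneModel
  Literature.NumberTheory.EllipticCurves.DescendedFrobenius.KatzFrobenius

namespace Literature.NumberTheory.EllipticCurves.DescendedFrobenius.NineNamedFactOfKatzRank

variable {W : WeierstrassCurve ℚ}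

/-- **`isDescendedFrobeniusMatrix_exists` FROM THE SUPERSINGULAR-ONLY RANK STATEMENT.** Same composition as
`isDescendedFrobeniusMatrix_exists_of_katzRankLeTwo`, but the rank statement is asked only for Weierstrass equations over
`𝓞` whose (elliptic) special fibre has trace divisible by `3` — the only case the descended-Frobenius programme meets
(`3 ∣ 𝓜.specialFibreTrace ρ`, and `HasseManin.tr (𝓜.E ⊗_ρ 𝔽₃) = 𝓜.specialFibreTrace ρ` by
`NineHonda.tr_specialFibre_eq`). With (i) `classEta` of the second kind and (ii) `classEta ∉ ℚ₃(ζ₉)·classOmega`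
modulo bounded denominators on such models, the named fact follows.
[cite: Katz1981CrystallineDieudonne, Thm. 5.3.3 and Thm. 5.1.4] [cite: BerthelotOgus1983, Prop. (3.14)] -/
theorem isDescendedFrobeniusMatrix_exists_of_katzRankLeTwo_supersingular
    (hK : ∀ (E : WeierstrassCurve ONine) (ρ : ONine →+* ZMod 3), IsUnit (E.map ρ).Δ →
      (3 : ℤ) ∣ Literature.NumberTheory.EllipticCurves.HasseManin.tr (E.map ρ) →
      ∀ f : Fin 3 → KNine⟦X⟧,
        (∀ i, constantCoeff (f i) = 0 ∧
          (∃ d : ℕ, ∀ n : ℕ, IsIntegral ℤ_[3] ((3 : KNine) ^ d * ((n : KNine) * coeff n (f i)))) ∧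
          (∃ d' : ℕ, ∀ e : Fin 2 →₀ ℕ, IsIntegral ℤ_[3] ((3 : KNine) ^ d' * MvPowerSeries.coeff e
            ((f i).subst (E.map (algebraMap ONine KNine)).formalGroupLaw - (f i).subst (MvPowerSeries.X 0) -
              (f i).subst (MvPowerSeries.X 1))))) →
        ∃ a : Fin 3 → KNine, a ≠ 0 ∧ HasBoundedDenominators (∑ i, PowerSeries.C (a i) * f i))
    (hη : ∀ (W : WeierstrassCurve ℚ) (𝓜 : W.NineGoodModel) (ρ : ONine →+* ZMod 3), (3 : ℤ) ∣ 𝓜.specialFibreTrace ρ →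
      (∃ d : ℕ, ∀ n : ℕ, IsIntegral ℤ_[3] ((3 : KNine) ^ d * ((n : KNine) * coeff n 𝓜.classEta))) ∧
      (∃ d' : ℕ, ∀ e : Fin 2 →₀ ℕ, IsIntegral ℤ_[3] ((3 : KNine) ^ d' * MvPowerSeries.coeff e
        (𝓜.classEta.subst (𝓜.E.map (algebraMap ONine KNine)).formalGroupLaw -
          𝓜.classEta.subst (MvPowerSeries.X 0) - 𝓜.classEta.subst (MvPowerSeries.X 1)))))
    (hηω : ∀ (W : WeierstrassCurve ℚ) (𝓜 : W.NineGoodModel) (ρ : ONine →+* ZMod 3), (3 : ℤ) ∣ 𝓜.specialFibreTrace ρ →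
      ∀ c : KNine, ¬ HasBoundedDenominators (𝓜.classEta - PowerSeries.C c * 𝓜.classOmega)) :
    WeierstrassCurve.isDescendedFrobeniusMatrix_exists := by
  -- model transport (g8)
  have hT : ∀ (W : WeierstrassCurve ℚ) (𝓜₁ 𝓜₂ : W.NineGoodModel) (c d : KNine),
      HasBoundedDenominators (expand 3 (by norm_num) 𝓜₂.classOmega - PowerSeries.C c * 𝓜₂.classOmega -
        PowerSeries.C d * 𝓜₂.classEta) →
      HasBoundedDenominators (expand 3 (by norm_num) 𝓜₁.classOmega - PowerSeries.C c * 𝓜₁.classOmega -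
        PowerSeries.C d * 𝓜₁.classEta) := fun W 𝓜₁ 𝓜₂ c d h => by
    simpa using (hbd_omegaColumn_iff 𝓜₂ 𝓜₁ 1 c d).mp (by simpa using h)
  refine isDescendedFrobeniusMatrix_exists_of_etaPosition hT fun W 𝓜 ρ hss => ?_
  set Ω := 𝓜.classOmega with hΩ
  set H := 𝓜.classEta with hH
  have hunit : IsUnit (𝓜.E.map ρ).Δ := by rw [WeierstrassCurve.map_Δ]; exact 𝓜.isUnit_Δ.map ρ
  have htr : (3 : ℤ) ∣ Literature.NumberTheory.EllipticCurves.HasseManin.tr (𝓜.E.map ρ) := by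
    rwa [NineHonda.tr_specialFibre_eq 𝓜 ρ]
  have hηc0 : constantCoeff H = 0 := by
    rw [hH, WeierstrassCurve.NineGoodModel.classEta, map_add, smul_eq_C_mul, smul_eq_C_mul, map_mul, map_mul,
      WeierstrassCurve.constantCoeff_formalEtaIntegral, WeierstrassCurve.constantCoeff_formalLog, mul_zero, mul_zero,
      add_zero]
  obtain ⟨hηd, hηd'⟩ := hη W 𝓜 ρ hss
  let f : Fin 3 → KNine⟦X⟧ := ![Ω, expand 3 (by norm_num) Ω, H]
  have hf : ∀ i, constantCoeff (f i) = 0 ∧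
      (∃ d : ℕ, ∀ n : ℕ, IsIntegral ℤ_[3] ((3 : KNine) ^ d * ((n : KNine) * coeff n (f i)))) ∧
      (∃ d' : ℕ, ∀ e : Fin 2 →₀ ℕ, IsIntegral ℤ_[3] ((3 : KNine) ^ d' * MvPowerSeries.coeff e
        ((f i).subst (𝓜.E.map (algebraMap ONine KNine)).formalGroupLaw - (f i).subst (MvPowerSeries.X 0) -
          (f i).subst (MvPowerSeries.X 1)))) := by
    intro i
    fin_cases i
    · exact secondKind_classOmega 𝓜
    · exact secondKind_expand_classOmega 𝓜 ρ
    · exact ⟨hηc0, hηd, hηd'⟩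
  obtain ⟨a, ha, hdep⟩ := hK 𝓜.E ρ hunit htr f hf
  rw [Fin.sum_univ_three] at hdep
  change HasBoundedDenominators (PowerSeries.C (a 0) * Ω + PowerSeries.C (a 1) * expand 3 (by norm_num) Ω +
    PowerSeries.C (a 2) * H) at hdep
  -- the `η`-coefficient is non-zero: otherwise `([ω], φ[ω])` would be dependent
  have ha2 : a 2 ≠ 0 := by
    intro h2
    rw [h2, map_zero, zero_mul, add_zero] at hdep
    obtain ⟨h0, h1⟩ := omegaPlane_independent 𝓜 ρ hss (hT W) (a 0) (a 1) hdep
    apply ha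
    ext i
    fin_cases i
    · exact h0
    · exact h1
    · exact h2
  -- normalise: `η ≡ A ω + B φω`
  set A : KNine := -(a 0 * (a 2)⁻¹) with hA
  set B : KNine := -(a 1 * (a 2)⁻¹) with hB
  have hpos : HasBoundedDenominators (H - PowerSeries.C A * Ω - PowerSeries.C B * expand 3 (by norm_num) Ω) := by
    have h := hbd_C_mul (a 2)⁻¹ hdep
    have e : PowerSeries.C (a 2)⁻¹ * (PowerSeries.C (a 0) * Ω + PowerSeries.C (a 1) * expand 3 (by norm_num) Ω +
        PowerSeries.C (a 2) * H) = H - PowerSeries.C A * Ω - PowerSeries.C B * expand 3 (by norm_num) Ω := by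
      rw [hA, hB, map_neg, map_neg, map_mul, map_mul]
      linear_combination H * C_mul_C_inv ha2
    rwa [e] at h
  have hBne : B ≠ 0 := by
    intro hB0
    rw [hB0, map_zero, zero_mul, sub_zero] at hpos
    exact hηω W 𝓜 ρ hss A hpos
  exact ⟨A, B, hBne, hpos⟩

end Literature.NumberTheory.EllipticCurves.DescendedFrobenius.NineNamedFactOfKatzRank

end Part2

/-!
## Part 3 — port of `Summits/BirchSwinnertonDyer/BirchSwinnertonDyer/Theorems/CyclotomicUntwistNineRankTwoReduction.lean` (1 declarations kept)

# `isDescendedFrobeniusMatrix_exists` ⟸ the pure rank-`2` statement — `B ≠ 0`, model transport, both independences, `ℚ₃`-rationality, `det/tr` and the power maps are all kernel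

Declarations of this Part (verbatim port; each keeps its own docstring and citation): `isDescendedFrobeniusMatrix_exists_of_katzRank_supersingular`.

Reference keys (see `references.bib` and the declarations' citations): [Katz1981CrystallineDieudonne].
-/

section Part3

open scoped _root_.Classical
open _root_.PowerSeries _root_.IsCyclotomicExtension Literature.NumberTheory.EllipticCurves.DescendedFrobenius
  Literature.NumberTheory.EllipticCurves.DescendedFrobenius.NineIntegers
  Literature.NumberTheory.EllipticCurves.DescendedFrobenius.DescendedFrobeniusTransfer
  Literature.NumberTheory.EllipticCurves.DescendedFrobenius.NineDescendedFrobeniusOfOmegaColumn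
  Literature.NumberTheory.EllipticCurves.DescendedFrobenius.NineClassesIndependent
  Literature.NumberTheory.EllipticCurves.DescendedFrobenius.NineHondaEstimate
  Literature.NumberTheory.EllipticCurves.DescendedFrobenius.NineHonda

namespace Literature.NumberTheory.EllipticCurves.DescendedFrobenius.NineRankTwoReduction

variable {W : WeierstrassCurve ℚ}

/-- The same from the SUPERSINGULAR-restricted rank statement (the binder form `H3 → …` lane produces).
[cite: Katz1981CrystallineDieudonne, Thm. 5.3.3] -/
theorem isDescendedFrobeniusMatrix_exists_of_katzRank_supersingular
    (hK : ∀ (E : WeierstrassCurve ONine) (ρ : ONine →+* ZMod 3), IsUnit (E.map ρ).Δ →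
      (3 : ℤ) ∣ Literature.NumberTheory.EllipticCurves.HasseManin.tr (E.map ρ) →
      ∀ f : Fin 3 → KNine⟦X⟧,
        (∀ i, constantCoeff (f i) = 0 ∧
          (∃ d : ℕ, ∀ n : ℕ, IsIntegral ℤ_[3] ((3 : KNine) ^ d * ((n : KNine) * coeff n (f i)))) ∧
          (∃ d' : ℕ, ∀ e : Fin 2 →₀ ℕ, IsIntegral ℤ_[3] ((3 : KNine) ^ d' * MvPowerSeries.coeff e
            ((f i).subst (E.map (algebraMap ONine KNine)).formalGroupLaw - (f i).subst (MvPowerSeries.X 0) -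
              (f i).subst (MvPowerSeries.X 1))))) →
        ∃ a : Fin 3 → KNine, a ≠ 0 ∧ HasBoundedDenominators (∑ i, PowerSeries.C (a i) * f i)) :
    WeierstrassCurve.isDescendedFrobeniusMatrix_exists :=
  NineNamedFactOfKatzRank.isDescendedFrobeniusMatrix_exists_of_katzRankLeTwo_supersingular hK
    (fun _ 𝓜 _ _ => secondKind_classEta 𝓜) (fun _ 𝓜 ρ hss c => not_hbd_classEta_sub_C_mul_classOmega 𝓜 ρ hss c)

end Literature.NumberTheory.EllipticCurves.DescendedFrobenius.NineRankTwoReduction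

end Part3

/-!
## Part 4 — port of `Summits/BirchSwinnertonDyer/BirchSwinnertonDyer/Theorems/CyclotomicUntwistDescendedFrobeniusMatrixExistsHolds.lean` (1 declarations kept)

# The named fact `WeierstrassCurve.isDescendedFrobeniusMatrix_exists` holds — Berthelot–Ogus/Katz existence of the descended Frobenius matrix on every supersingular good model, now a theorem

Declarations of this Part (verbatim port; each keeps its own docstring and citation): `isDescendedFrobeniusMatrix_exists_holds`.

Reference keys (see `references.bib` and the declarations' citations): [BerthelotOgus1983], [Katz1981CrystallineDieudonne].
-/

section Part4

open _root_.PowerSeries Literature.NumberTheory.EllipticCurves Literature.NumberTheory.EllipticCurves.DescendedFrobenius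

namespace Literature.NumberTheory.EllipticCurves.DescendedFrobenius.FormalEndomorphismPadicDigits

/-- **The named fact `WeierstrassCurve.isDescendedFrobeniusMatrix_exists` HOLDS**: for every `W/ℚ`, every good model
`𝓜` over `𝓞_{ℚ₃(ζ₉)}` and every reduction `ρ` with `3 ∣ 𝓜.specialFibreTrace ρ`, a descended Frobenius matrix with
that trace exists. [cite: BerthelotOgus1983, Prop. (3.14)] [cite: Katz1981CrystallineDieudonne, Thm. 5.1.4, 5.3.3, 5.7.2 and (6.1.1)] -/
theorem _root_.WeierstrassCurve.isDescendedFrobeniusMatrix_exists_holds : WeierstrassCurve.isDescendedFrobeniusMatrix_exists :=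
  NineRankTwoReduction.isDescendedFrobeniusMatrix_exists_of_katzRank_supersingular katzRankLeTwo_supersingular

end Literature.NumberTheory.EllipticCurves.DescendedFrobenius.FormalEndomorphismPadicDigits

end Part4

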